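import Literature.Analysis.ODE.NonlinearFractionalGronwall
import Mathlib.Analysis.SpecialFunctions.Pow.Real
import Mathlib.Analysis.SpecialFunctions.Log.Basic
import Mathlib.Algebra.Order.Field.GeomSum
import Mathlib.Topology.Algebra.InfiniteSum.Real
import HarnessLib

/-!
# Volterra bounds with a lacunary coefficient: the power loss `(t/t₀)^{O(η)}` of
  Coiculescu–Palasek, Prop. 4.2, in forcing form

Analysis/ODE support file (pure real analysis, everything proved) on the proof path of the
perturbation step of M. P. Coiculescu, S. Palasek, *Non-uniqueness of smooth solutions of the
Navier–Stokes equations from critical data*, Invent. Math. 244 (2025) = arXiv:2503.14699,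
Props. 4.2–4.3 (the explicit hypothesis `hB` of
`Literature.Barriers.NavierStokesRegularity.CriticalDataSmoothNonuniqueness_of_principalParts_of_perturbationThreshold`).
The proof of Prop. 4.2 bounds `h(t) = t^{1/2}‖S(t,t')a‖_{L^∞}` through the endpoint fractional
Grönwall inequality (App. B, Lemma B.3; the tree's
`Literature.Analysis.ODE.fractional_gronwall_three`) and then invokes the two estimates of
Prop. 3.13 on the principal part `v` — `‖v(s)‖_∞ ≲ s^{-1/2}` and the LACUNARITY bound
`‖v‖²_{L²([t₁,t₂];L^∞)} + ‖v‖_{L¹([t₁,t₂],s^{-1/2}ds;L^∞)} ≲ 1 + (log A)⁻¹ log(t₂/t₁)` — to turn the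
exponential of the Grönwall lemma into the mild power loss `(t/t')^{O(1/log A)}` ("The exponential
factor becomes `O((t/t')^{O(1/log A)})`. Choosing `A` sufficiently large depending on `ε`, the
power becomes smaller than `ε/2`"). This file isolates that step and the three elementary
real-variable estimates around it that the FORCING form of the linear estimate uses (the linear
problem `∂ₜw - Δw + ℙ∇·(v ⊗ w + w ⊗ v) = ℙ∇·G`, `w(t') = 0`, in place of the semigroup
`S(t,t')`; see the session notes of the barrier's seat B):

* `sqrt_div_mul_rpow_neg_half_le` — the kernel comparison
  `√(t/s) (t-s)^{-1/2} ≤ √2 (s^{-1/2} + (t-s)^{-1/2})` for `0 < s < t`, which puts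
  `√t ∫ (t-s)^{-1/2} ‖v(s)‖ ‖w(s)‖ ds` in the shape of Lemma B.3 for `h = √t ‖w(t)‖`;
* `lacunary_gronwall_power` — **Lemma B.3 + (3.13a) + (3.13b) ⇒ power loss**: if `f ≥ 0` is
  continuous on `[t₀, T]` (`t₀ > 0`) with
  `f(t) ≤ a + ∫_{t₀}^t √2 (s^{-1/2} + (t-s)^{-1/2}) V(s) f(s) ds`, where the continuous coefficient
  `V ≥ 0` obeys `√s V(s) ≤ K₀` and `∫_{t₀}^t (V² + s^{-1/2}V) ≤ C (1 + η log(t/t₀))`, then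
  `f(t) ≤ C₀ a e^{C₀(1+2K₀)C} (t/t₀)^{C₀(1+2K₀)Cη}` with an absolute constant `C₀`;
* `sqrt_mul_setIntegral_layer_le` — the size of the free term generated by one dyadic layer of
  forcing: `√t ∫_{(tⱼ, t ∧ 2tⱼ)} (t-s)^{-1/2} s^{α-1} ds ≤ 7 tⱼ^α` for `α ≤ 1`, `0 < tⱼ ≤ t`;
* `sum_range_dyadic_rpow_le`, `tsum_dyadic_rpow_le` — resummation of the layers:
  `Σ_{j : T2^{-j} < t} (T 2^{-j})^β ≤ t^β / (1 - 2^{-β})` for `β > 0`.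

## Mathlib / tree search

Tree: `Literature.Analysis.ODE.fractional_gronwall_three` (Lemma B.3, `p = 3`),
`Literature.Analysis.ODE.setIntegral_Ioo_sub_rpow_neg`. Mathlib: `integral_rpow`,
`intervalIntegral.integral_comp_sub_left`, `geom_sum_Ico_le_of_lt_one`,
`summable_of_sum_range_le`, `Real.tsum_le_of_sum_range_le`, `Real.rpow_def_of_pos`.

## References

* M. P. Coiculescu, S. Palasek, Invent. Math. 244 (2025), 165–219 = arXiv:2503.14699: proof of
  Prop. 4.2 (the displays from "Letting `h(t) = t^{1/2}‖S(t,t')a‖_{L^∞}`" to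
  "`‖S(t,t')a‖_{L^∞} ≲ t^{-1/2}(t')^{-1+α}(t/t')^{ε/2}‖a‖_Y`"), Prop. 3.13, App. B Lemma B.3.
  [`CoiculescuPalasek2025`]
-/

noncomputable section

open MeasureTheory Set Filter intervalIntegral
open _root_.Topology

namespace Literature.Analysis.ODE

/-! ### The kernel comparison -/

/-- `x^{-1/2} = (√x)⁻¹` for `x ≥ 0`. [folklore] -/
theorem rpow_neg_half_eq_inv_sqrt {x : ℝ} (hx : 0 ≤ x) : x ^ (-(1 / 2 : ℝ)) = (Real.sqrt x)⁻¹ := by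
  rw [Real.rpow_neg hx, Real.sqrt_eq_rpow]

/-- **Kernel comparison** `√(t/s) · (t-s)^{-1/2} ≤ √2 (s^{-1/2} + (t-s)^{-1/2})` for `0 < s < t`:
for `s ≥ t/2` the first factor is at most `√2`; for `s < t/2` one has `t - s > t/2`, so
`(t-s)^{-1/2} < √2 t^{-1/2}` and `√(t/s) √2 t^{-1/2} = √2 s^{-1/2}`. This converts
`√t ∫_{t'}^t (t-s)^{-1/2} ‖v(s)‖ ‖w(s)‖ ds = ∫ √(t/s)(t-s)^{-1/2} ‖v(s)‖ (√s‖w(s)‖) ds` into the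
form of Lemma B.3 (proof of Prop. 4.2 of Coiculescu–Palasek: "`(t/s)^{1/2} ≤ √2` on the interval
`s ∈ [t' ∨ (t/2), t]`"). [cite: CoiculescuPalasek2025, proof of Prop. 4.2] -/
theorem sqrt_div_mul_rpow_neg_half_le {s t : ℝ} (hs : 0 < s) (hst : s < t) :
    Real.sqrt (t / s) * (t - s) ^ (-(1 / 2 : ℝ)) ≤
      Real.sqrt 2 * (s ^ (-(1 / 2 : ℝ)) + (t - s) ^ (-(1 / 2 : ℝ))) := by
  have ht : 0 < t := hs.trans hst
  have hts : 0 < t - s := sub_pos.2 hst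
  rw [rpow_neg_half_eq_inv_sqrt hs.le, rpow_neg_half_eq_inv_sqrt hts.le,
    Real.sqrt_div' t hs.le]
  have hss : 0 < Real.sqrt s := Real.sqrt_pos.2 hs
  have hst' : 0 < Real.sqrt (t - s) := Real.sqrt_pos.2 hts
  have hs2 : 0 < Real.sqrt 2 := Real.sqrt_pos.2 (by norm_num)
  have hst0 : 0 < Real.sqrt t := Real.sqrt_pos.2 ht
  rcases le_or_gt (t / 2) s with h | h
  · -- `s ≥ t/2`: `√(t/s) ≤ √2`
    have h1 : Real.sqrt t / Real.sqrt s ≤ Real.sqrt 2 := by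
      rw [div_le_iff₀ hss, ← Real.sqrt_mul (by norm_num : (0 : ℝ) ≤ 2)]
      exact Real.sqrt_le_sqrt (by linarith)
    calc Real.sqrt t / Real.sqrt s * (Real.sqrt (t - s))⁻¹
        ≤ Real.sqrt 2 * (Real.sqrt (t - s))⁻¹ :=
          mul_le_mul_of_nonneg_right h1 (inv_nonneg.2 hst'.le)
      _ ≤ Real.sqrt 2 * ((Real.sqrt s)⁻¹ + (Real.sqrt (t - s))⁻¹) := by
          gcongr
          exact le_add_of_nonneg_left (inv_nonneg.2 hss.le)
  · -- `s < t/2`: `(t-s)^{-1/2} ≤ √2/√t`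
    have h1 : (Real.sqrt (t - s))⁻¹ ≤ Real.sqrt 2 / Real.sqrt t := by
      rw [inv_le_iff_one_le_mul₀ hst', div_mul_eq_mul_div, one_le_div hst0,
        ← Real.sqrt_mul (by norm_num : (0 : ℝ) ≤ 2)]
      exact Real.sqrt_le_sqrt (by linarith)
    calc Real.sqrt t / Real.sqrt s * (Real.sqrt (t - s))⁻¹
        ≤ Real.sqrt t / Real.sqrt s * (Real.sqrt 2 / Real.sqrt t) :=
          mul_le_mul_of_nonneg_left h1 (div_nonneg hst0.le hss.le)
      _ = Real.sqrt 2 * (Real.sqrt s)⁻¹ := by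
          field_simp
      _ ≤ Real.sqrt 2 * ((Real.sqrt s)⁻¹ + (Real.sqrt (t - s))⁻¹) := by
          gcongr
          exact le_add_of_nonneg_right (inv_nonneg.2 hst'.le)

/-! ### Lemma B.3 with a lacunary coefficient: the power loss -/

/-- **Fractional Grönwall with a lacunary coefficient gives a power loss** (Coiculescu–Palasek
2025, proof of Prop. 4.2: Lemma B.3 with `p = 3`, `g₁ = s^{-1/2}‖v(s)‖_∞`, `g₂ = ‖v(s)‖_∞`, then
"By (3.13a)–(3.13b), we may estimate the norms in the exponent to obtain
`h(t) ≲ (t')^{-1+α}‖a‖_Y exp(O(1 + (log A)⁻¹ log(t/t')))`. The exponential factor becomes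
`O((t/t')^{O(1/log A)})`"). Abstract form: there is an absolute constant `C₀ > 0` such that for
`0 < t₀`, continuous `f, V ≥ 0` on `[t₀, T]`, constants `a, K₀, C, η ≥ 0` with
`√s V(s) ≤ K₀` ((3.13a), `m = 0`) and `∫_{t₀}^t (V(s)² + s^{-1/2}V(s)) ds ≤ C(1 + η log(t/t₀))`
((3.13b) with slope `η`) on `[t₀, T]`, the Volterra inequality
`f(t) ≤ a + ∫_{t₀}^t √2 (s^{-1/2} + (t-s)^{-1/2}) V(s) f(s) ds` implies
`f(t) ≤ C₀ a e^{C₀(1+2K₀)C} (t/t₀)^{C₀(1+2K₀)Cη}` for all `t ∈ [t₀, T]`. (Lemma B.3 gives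
`f ≤ C_G a exp(C_G(√2∫s^{-1/2}V + √2K₀ · 2∫V²))`, and
`√2∫s^{-1/2}V + 2√2K₀∫V² ≤ √2(1+2K₀) C (1 + η log(t/t₀))`; `C₀ = 2C_G`.)
[cite: CoiculescuPalasek2025, proof of Prop. 4.2 with Prop. 3.13 and App. B Lemma B.3] -/
theorem lacunary_gronwall_power :
    ∃ C₀ : ℝ, 0 < C₀ ∧ ∀ ⦃t₀ T : ℝ⦄ ⦃f V : ℝ → ℝ⦄ ⦃a K₀ C η : ℝ⦄, 0 < t₀ →
      ContinuousOn f (Icc t₀ T) → ContinuousOn V (Icc t₀ T) →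
      (∀ t ∈ Icc t₀ T, 0 ≤ f t) → (∀ t ∈ Icc t₀ T, 0 ≤ V t) →
      0 ≤ a → 0 ≤ K₀ → 0 ≤ C → 0 ≤ η →
      (∀ s ∈ Icc t₀ T, Real.sqrt s * V s ≤ K₀) →
      (∀ t ∈ Icc t₀ T,
        ∫ s in t₀..t, (V s ^ 2 + s ^ (-(1 / 2 : ℝ)) * V s) ≤ C * (1 + η * Real.log (t / t₀))) →
      (∀ t ∈ Icc t₀ T, f t ≤ a + ∫ s in t₀..t,
        Real.sqrt 2 * (s ^ (-(1 / 2 : ℝ)) + (t - s) ^ (-(1 / 2 : ℝ))) * V s * f s) →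
      ∀ ⦃t : ℝ⦄, t ∈ Icc t₀ T →
        f t ≤ C₀ * a * Real.exp (C₀ * (1 + 2 * K₀) * C) *
          (t / t₀) ^ (C₀ * (1 + 2 * K₀) * C * η) := by
  obtain ⟨CG, hCG, hG⟩ := fractional_gronwall_three
  refine ⟨2 * CG, by positivity, ?_⟩
  intro t₀ T f V a K₀ C η ht₀ hf hV hf0 hV0 ha hK₀ hC hη hKT hlac hineq t ht
  have hs2 : 0 ≤ Real.sqrt 2 := Real.sqrt_nonneg 2
  have hs2' : Real.sqrt 2 ≤ 2 := by
    rw [show (2 : ℝ) = Real.sqrt 4 by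
      rw [show (4 : ℝ) = 2 ^ 2 by norm_num, Real.sqrt_sq (by norm_num : (0 : ℝ) ≤ 2)]]
    exact Real.sqrt_le_sqrt (by norm_num)
  -- the two coefficient functions of Lemma B.3
  set g₁ : ℝ → ℝ := fun s => Real.sqrt 2 * (s ^ (-(1 / 2 : ℝ)) * V s) with hg₁
  set g₂ : ℝ → ℝ := fun s => Real.sqrt 2 * V s with hg₂
  have hpow : ContinuousOn (fun s : ℝ => s ^ (-(1 / 2 : ℝ))) (Icc t₀ T) := fun s hs =>
    (Real.continuousAt_rpow_const _ _ (Or.inl (ht₀.trans_le hs.1).ne')).continuousWithinAt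
  have hg₁c : ContinuousOn g₁ (Icc t₀ T) := continuousOn_const.mul (hpow.mul hV)
  have hg₂c : ContinuousOn g₂ (Icc t₀ T) := continuousOn_const.mul hV
  have hg₁0 : ∀ s ∈ Icc t₀ T, 0 ≤ g₁ s := fun s hs =>
    mul_nonneg hs2 (mul_nonneg (Real.rpow_nonneg (ht₀.le.trans hs.1) _) (hV0 s hs))
  have hg₂0 : ∀ s ∈ Icc t₀ T, 0 ≤ g₂ s := fun s hs => mul_nonneg hs2 (hV0 s hs)
  -- the hypothesis in the shape of Lemma B.3
  have hineq' : ∀ τ ∈ Icc t₀ T,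
      f τ ≤ (fun _ => a) τ + ∫ s in t₀..τ, (g₁ s + (τ - s) ^ (-(1 / 2 : ℝ)) * g₂ s) * f s := by
    intro τ hτ
    refine (hineq τ hτ).trans_eq ?_
    congr 1
    refine integral_congr fun s _ => ?_
    simp only [hg₁, hg₂]
    ring
  have hM : ∀ s ∈ Icc t₀ t, Real.sqrt s * g₂ s ≤ Real.sqrt 2 * K₀ := by
    intro s hs
    have h := hKT s ⟨hs.1, hs.2.trans ht.2⟩
    calc Real.sqrt s * g₂ s = Real.sqrt 2 * (Real.sqrt s * V s) := by simp only [hg₂]; ring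
      _ ≤ Real.sqrt 2 * K₀ := mul_le_mul_of_nonneg_left h hs2
  have hmain := hG ht₀.le hf hg₁c hg₂c hf0 hg₁0 hg₂0 (fun _ _ => ha) (fun _ _ _ _ _ => le_rfl)
    hineq' ht hM
  -- the exponent of Lemma B.3 is at most `√2 (1 + 2K₀) C (1 + η log (t/t₀))`
  have htt₀ : t₀ ≤ t := ht.1
  have hVi : IntervalIntegrable (fun s => V s ^ 2 + s ^ (-(1 / 2 : ℝ)) * V s) volume t₀ t := by
    refine ContinuousOn.intervalIntegrable ?_
    rw [uIcc_of_le htt₀]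
    have hV' : ContinuousOn V (Icc t₀ t) := hV.mono (Icc_subset_Icc le_rfl ht.2)
    exact (hV'.pow 2).add ((hpow.mono (Icc_subset_Icc le_rfl ht.2)).mul hV')
  have hnn : ∀ s ∈ Icc t₀ t, 0 ≤ V s ^ 2 ∧ 0 ≤ s ^ (-(1 / 2 : ℝ)) * V s := fun s hs =>
    ⟨sq_nonneg _, mul_nonneg (Real.rpow_nonneg (ht₀.le.trans hs.1) _)
      (hV0 s ⟨hs.1, hs.2.trans ht.2⟩)⟩
  have hI : 0 ≤ ∫ s in t₀..t, (V s ^ 2 + s ^ (-(1 / 2 : ℝ)) * V s) :=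
    intervalIntegral.integral_nonneg htt₀ fun s hs => add_nonneg (hnn s hs).1 (hnn s hs).2
  have h1 : ∫ s in t₀..t, g₁ s ≤
      Real.sqrt 2 * ∫ s in t₀..t, (V s ^ 2 + s ^ (-(1 / 2 : ℝ)) * V s) := by
    have he : ∫ s in t₀..t, g₁ s = Real.sqrt 2 * ∫ s in t₀..t, s ^ (-(1 / 2 : ℝ)) * V s := by
      simp only [hg₁]
      exact intervalIntegral.integral_const_mul _ _
    rw [he]
    refine mul_le_mul_of_nonneg_left ?_ hs2
    refine intervalIntegral.integral_mono_on htt₀ ?_ hVi fun s hs => ?_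
    · refine ContinuousOn.intervalIntegrable ?_
      rw [uIcc_of_le htt₀]
      exact (hpow.mono (Icc_subset_Icc le_rfl ht.2)).mul (hV.mono (Icc_subset_Icc le_rfl ht.2))
    · exact le_add_of_nonneg_left (hnn s hs).1
  have h2 : ∫ s in t₀..t, g₂ s ^ 2 ≤ 2 * ∫ s in t₀..t, (V s ^ 2 + s ^ (-(1 / 2 : ℝ)) * V s) := by
    have he : ∫ s in t₀..t, g₂ s ^ 2 = 2 * ∫ s in t₀..t, V s ^ 2 := by
      have : (fun s => g₂ s ^ 2) = fun s => 2 * V s ^ 2 := by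
        funext s
        simp only [hg₂, mul_pow, Real.sq_sqrt (show (0 : ℝ) ≤ 2 by norm_num)]
      rw [this]
      exact intervalIntegral.integral_const_mul _ _
    rw [he]
    refine mul_le_mul_of_nonneg_left ?_ (by norm_num)
    refine intervalIntegral.integral_mono_on htt₀ ?_ hVi fun s hs => ?_
    · refine ContinuousOn.intervalIntegrable ?_
      rw [uIcc_of_le htt₀]
      exact (hV.mono (Icc_subset_Icc le_rfl ht.2)).pow 2
    · exact le_add_of_nonneg_right (hnn s hs).2
  set I : ℝ := ∫ s in t₀..t, (V s ^ 2 + s ^ (-(1 / 2 : ℝ)) * V s) with hIdef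
  have hexp : CG * ((∫ s in t₀..t, g₁ s) + Real.sqrt 2 * K₀ * ∫ s in t₀..t, g₂ s ^ 2) ≤
      2 * CG * (1 + 2 * K₀) * C * (1 + η * Real.log (t / t₀)) := by
    have hlog : 0 ≤ Real.log (t / t₀) := Real.log_nonneg ((one_le_div ht₀).2 htt₀)
    have hL := hlac t ht
    calc CG * ((∫ s in t₀..t, g₁ s) + Real.sqrt 2 * K₀ * ∫ s in t₀..t, g₂ s ^ 2)
        ≤ CG * (Real.sqrt 2 * I + Real.sqrt 2 * K₀ * (2 * I)) := by
          gcongr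
      _ = CG * Real.sqrt 2 * (1 + 2 * K₀) * I := by ring
      _ ≤ CG * 2 * (1 + 2 * K₀) * (C * (1 + η * Real.log (t / t₀))) := by
          gcongr
      _ = 2 * CG * (1 + 2 * K₀) * C * (1 + η * Real.log (t / t₀)) := by ring
  -- conclusion
  have htt : 0 < t / t₀ := div_pos (ht₀.trans_le htt₀) ht₀
  calc f t ≤ CG * a * Real.exp (CG * ((∫ s in t₀..t, g₁ s) +
        Real.sqrt 2 * K₀ * ∫ s in t₀..t, g₂ s ^ 2)) := hmain
    _ ≤ 2 * CG * a * Real.exp (2 * CG * (1 + 2 * K₀) * C * (1 + η * Real.log (t / t₀))) := by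
        gcongr
        · linarith
    _ = 2 * CG * a * Real.exp (2 * CG * (1 + 2 * K₀) * C) *
          (t / t₀) ^ (2 * CG * (1 + 2 * K₀) * C * η) := by
        rw [Real.rpow_def_of_pos htt, mul_assoc (2 * CG * a), ← Real.exp_add]
        congr 2
        ring

/-! ### The free term of one dyadic layer of forcing -/

/-- `∫_{(c, m)} (t - s)^{-1/2} ds = 2 (√(t - c) - √(t - m))` for `c ≤ m` (meaningful for `m ≤ t`;
for `m > t` both sides carry Mathlib's junk conventions `√x = 0`, `x^{1/2} = 0` for `x < 0`).
[folklore] -/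
theorem setIntegral_Ioo_sub_rpow_neg_half {c m : ℝ} (t : ℝ) (hcm : c ≤ m) :
    ∫ s in Ioo c m, (t - s) ^ (-(1 / 2 : ℝ)) = 2 * (Real.sqrt (t - c) - Real.sqrt (t - m)) := by
  rw [← integral_Ioc_eq_integral_Ioo, ← intervalIntegral.integral_of_le hcm,
    intervalIntegral.integral_comp_sub_left (fun s : ℝ => s ^ (-(1 / 2 : ℝ))) t,
    integral_rpow (Or.inl (by norm_num))]
  have h1 : -(1 / 2 : ℝ) + 1 = 1 / 2 := by norm_num
  rw [h1, ← Real.sqrt_eq_rpow, ← Real.sqrt_eq_rpow]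
  ring

/-- **The free term of one dyadic layer.** For `α ≤ 1` and `0 < tⱼ ≤ t`:
`√t ∫_{(tⱼ, t ∧ 2tⱼ)} (t-s)^{-1/2} s^{α-1} ds ≤ 7 tⱼ^α` — the sup-norm size, weighted by `√t`, of
the heat/Leray Duhamel integral `∫ e^{(t-s)Δ}ℙ∇·G(s) ds` of a forcing with `‖G(s)‖_∞ ≤ s^{α-1}`
supported in the layer `[tⱼ, 2tⱼ)` (kernel `‖∇e^{σΔ}ℙ‖_{L¹} ≲ σ^{-1/2}`). On the layer
`s^{α-1} ≤ tⱼ^{α-1}`; for `t ≤ 4tⱼ` the kernel integral is `≤ 2√(3tⱼ)` and `√t ≤ 2√tⱼ`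
(`4√3 < 7`); for `t ≥ 4tⱼ` it is `2(√(t-tⱼ) - √(t-2tⱼ)) ≤ √2 tⱼ/√t`. This is the constancy in
`t` of the weighted free term `a = sup √t ‖I‖` entering Lemma B.3 (Coiculescu–Palasek, proof of
Prop. 4.2, term `I`, here in forcing form). [cite: CoiculescuPalasek2025, proof of Prop. 4.2 (term I)] -/
theorem sqrt_mul_setIntegral_layer_le {α tj t : ℝ} (hα1 : α ≤ 1) (htj : 0 < tj) (ht : tj ≤ t) :
    Real.sqrt t * ∫ s in Ioo tj (min t (2 * tj)), (t - s) ^ (-(1 / 2 : ℝ)) * s ^ (α - 1) ≤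
      7 * tj ^ α := by
  set m : ℝ := min t (2 * tj) with hm
  have htjm : tj ≤ m := le_min ht (by linarith)
  have hmt : m ≤ t := min_le_left _ _
  have ht0 : 0 < t := htj.trans_le ht
  -- bound the weight on the layer and integrate the kernel exactly
  have hker : IntegrableOn (fun s : ℝ => (t - s) ^ (-(1 / 2 : ℝ))) (Ioo tj m) volume := by
    have h : IntervalIntegrable (fun s : ℝ => (t - s) ^ (-(1 / 2 : ℝ))) volume tj m := by
      have h1 : IntervalIntegrable (fun s : ℝ => s ^ (-(1 / 2 : ℝ))) volume (t - tj) (t - m) :=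
        intervalIntegral.intervalIntegrable_rpow' (by norm_num)
      have h2 := h1.comp_sub_left t
      simpa using h2
    rw [intervalIntegrable_iff_integrableOn_Ioo_of_le htjm] at h
    exact h
  have hwt : ∀ s ∈ Ioo tj m, s ^ (α - 1) ≤ tj ^ (α - 1) := fun s hs =>
    Real.rpow_le_rpow_of_nonpos htj hs.1.le (by linarith)
  have hprod_le : ∀ s ∈ Ioo tj m,
      (t - s) ^ (-(1 / 2 : ℝ)) * s ^ (α - 1) ≤ (t - s) ^ (-(1 / 2 : ℝ)) * tj ^ (α - 1) :=
    fun s hs => mul_le_mul_of_nonneg_left (hwt s hs)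
      (Real.rpow_nonneg (sub_nonneg.2 (hs.2.le.trans hmt)) _)
  have hprod_nn : ∀ s ∈ Ioo tj m, 0 ≤ (t - s) ^ (-(1 / 2 : ℝ)) * s ^ (α - 1) := fun s hs =>
    mul_nonneg (Real.rpow_nonneg (sub_nonneg.2 (hs.2.le.trans hmt)) _)
      (Real.rpow_nonneg (htj.le.trans hs.1.le) _)
  have hint : ∫ s in Ioo tj m, (t - s) ^ (-(1 / 2 : ℝ)) * s ^ (α - 1) ≤
      tj ^ (α - 1) * (2 * (Real.sqrt (t - tj) - Real.sqrt (t - m))) := by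
    rw [← setIntegral_Ioo_sub_rpow_neg_half t htjm, ← MeasureTheory.integral_const_mul]
    refine integral_mono_of_nonneg (ae_restrict_of_forall_mem measurableSet_Ioo hprod_nn)
      (hker.const_mul _) (ae_restrict_of_forall_mem measurableSet_Ioo fun s hs => ?_)
    show (t - s) ^ (-(1 / 2 : ℝ)) * s ^ (α - 1) ≤ tj ^ (α - 1) * (t - s) ^ (-(1 / 2 : ℝ))
    rw [mul_comm (tj ^ (α - 1))]
    exact hprod_le s hs
  have hsqt : 0 ≤ Real.sqrt t := Real.sqrt_nonneg t
  have htjα : 0 < tj ^ α := Real.rpow_pos_of_pos htj α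
  have htjα1 : tj ^ (α - 1) = tj ^ α / tj := by
    rw [Real.rpow_sub htj, Real.rpow_one]
  rcases le_or_gt t (4 * tj) with h4 | h4
  · -- `t ≤ 4 tⱼ`
    have hk : 2 * (Real.sqrt (t - tj) - Real.sqrt (t - m)) ≤ 2 * Real.sqrt (3 * tj) := by
      have h1 : Real.sqrt (t - tj) ≤ Real.sqrt (3 * tj) := Real.sqrt_le_sqrt (by linarith)
      linarith [Real.sqrt_nonneg (t - m)]
    have hst : Real.sqrt t ≤ 2 * Real.sqrt tj := by
      rw [show (2 : ℝ) * Real.sqrt tj = Real.sqrt (4 * tj) by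
        rw [Real.sqrt_mul (by norm_num : (0:ℝ) ≤ 4), show Real.sqrt 4 = 2 by
          rw [show (4:ℝ) = 2 ^ 2 by norm_num, Real.sqrt_sq (by norm_num : (0:ℝ) ≤ 2)]]]
      exact Real.sqrt_le_sqrt h4
    have h3 : Real.sqrt 3 ≤ 7 / 4 := by
      rw [show (7 / 4 : ℝ) = Real.sqrt ((7 / 4) ^ 2) by rw [Real.sqrt_sq (by norm_num)]]
      exact Real.sqrt_le_sqrt (by norm_num)
    calc Real.sqrt t * ∫ s in Ioo tj m, (t - s) ^ (-(1 / 2 : ℝ)) * s ^ (α - 1)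
        ≤ (2 * Real.sqrt tj) * (tj ^ (α - 1) * (2 * Real.sqrt (3 * tj))) := by
          refine mul_le_mul hst (hint.trans ?_) (setIntegral_nonneg measurableSet_Ioo hprod_nn)
            (by positivity)
          exact mul_le_mul_of_nonneg_left hk (Real.rpow_nonneg htj.le _)
      _ = 4 * Real.sqrt 3 * (Real.sqrt tj * Real.sqrt tj) * tj ^ (α - 1) := by
          rw [Real.sqrt_mul (by norm_num : (0:ℝ) ≤ 3)]
          ring
      _ = 4 * Real.sqrt 3 * tj ^ α := by
          rw [Real.mul_self_sqrt htj.le, htjα1]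
          field_simp
      _ ≤ 7 * tj ^ α := by nlinarith
  · -- `t > 4 tⱼ`: `m = 2 tⱼ` and `√(t-tⱼ) - √(t-2tⱼ) ≤ tⱼ / (√2 √t)`
    have hm2 : m = 2 * tj := min_eq_right (by linarith)
    have ha : 0 < t - tj := by linarith
    have hb : 0 < t - 2 * tj := by linarith
    have hsa : 0 < Real.sqrt (t - tj) := Real.sqrt_pos.2 ha
    have hsb : 0 < Real.sqrt (t - 2 * tj) := Real.sqrt_pos.2 hb
    have hdiff : Real.sqrt (t - tj) - Real.sqrt (t - 2 * tj) =
        tj / (Real.sqrt (t - tj) + Real.sqrt (t - 2 * tj)) := by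
      rw [eq_div_iff (by positivity)]
      have e1 := Real.mul_self_sqrt ha.le
      have e2 := Real.mul_self_sqrt hb.le
      nlinarith
    -- `√(t - tⱼ) + √(t - 2tⱼ) ≥ 2 √(t/2) = √2 √t`, i.e. `√t · tⱼ/(…) ≤ tⱼ/√2 ≤ tⱼ`
    have hden : Real.sqrt t ≤ Real.sqrt (t - tj) + Real.sqrt (t - 2 * tj) := by
      have h1 : Real.sqrt (t / 4) ≤ Real.sqrt (t - 2 * tj) := Real.sqrt_le_sqrt (by linarith)
      have h2 : Real.sqrt (t / 4) ≤ Real.sqrt (t - tj) := Real.sqrt_le_sqrt (by linarith)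
      have h3 : Real.sqrt (t / 4) = Real.sqrt t / 2 := by
        rw [Real.sqrt_div' t (by norm_num : (0:ℝ) ≤ 4), show Real.sqrt 4 = 2 by
          rw [show (4:ℝ) = 2 ^ 2 by norm_num, Real.sqrt_sq (by norm_num : (0:ℝ) ≤ 2)]]
      linarith
    have hpos : 0 < Real.sqrt (t - tj) + Real.sqrt (t - 2 * tj) := by positivity
    calc Real.sqrt t * ∫ s in Ioo tj m, (t - s) ^ (-(1 / 2 : ℝ)) * s ^ (α - 1)
        ≤ Real.sqrt t * (tj ^ (α - 1) * (2 * (Real.sqrt (t - tj) - Real.sqrt (t - m)))) :=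
          mul_le_mul_of_nonneg_left hint hsqt
      _ = 2 * tj ^ (α - 1) * tj * (Real.sqrt t / (Real.sqrt (t - tj) + Real.sqrt (t - 2 * tj))) := by
          rw [hm2, hdiff]
          ring
      _ ≤ 2 * tj ^ (α - 1) * tj * 1 := by
          refine mul_le_mul_of_nonneg_left ((div_le_one hpos).2 hden) ?_
          exact mul_nonneg (mul_nonneg (by norm_num) (Real.rpow_nonneg htj.le _)) htj.le
      _ = 2 * tj ^ α := by
          rw [htjα1]
          field_simp
      _ ≤ 7 * tj ^ α := by nlinarith

/-! ### Resummation of the dyadic layers -/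

/-- **Resummation of the dyadic layers.** For `β > 0`, `T > 0`, `t > 0` and every `n`:
`Σ_{j < n, T 2^{-j} < t} (T 2^{-j})^β ≤ t^β / (1 - 2^{-β})`: the admissible `j` start at the least
`j₀` with `T2^{-j₀} < t`, and from there the terms are dominated by the geometric series
`t^β Σ_k (2^{-β})^k`. This resums the per-layer bounds `∝ tⱼ^{α-ε} t^{ε}` of the linear estimate
into `∝ t^α` (Coiculescu–Palasek, proof of Prop. 4.3: "`∫₀ᵗ (t')^{-1+α-ε} dt'`", here discretised
dyadically). [cite: CoiculescuPalasek2025, proof of Prop. 4.3] -/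
theorem sum_range_dyadic_rpow_le {β T t : ℝ} (hβ : 0 < β) (hT : 0 < T) (ht : 0 < t) (n : ℕ) :
    ∑ j ∈ Finset.range n, (if T * (2 : ℝ)⁻¹ ^ j < t then (T * (2 : ℝ)⁻¹ ^ j) ^ β else 0) ≤
      t ^ β / (1 - (2 : ℝ) ^ (-β)) := by
  set q : ℝ := (2 : ℝ) ^ (-β) with hq
  have hq0 : 0 ≤ q := Real.rpow_nonneg (by norm_num) _
  have hq1 : q < 1 := Real.rpow_lt_one_of_one_lt_of_neg (by norm_num) (by linarith)
  have hq1' : 0 < 1 - q := by linarith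
  have htβ : 0 < t ^ β := Real.rpow_pos_of_pos ht β
  by_cases hex : ∃ j, T * (2 : ℝ)⁻¹ ^ j < t
  · classical
    let j₀ := Nat.find hex
    have hj₀ : T * (2 : ℝ)⁻¹ ^ j₀ < t := Nat.find_spec hex
    have hmin : ∀ j, T * (2 : ℝ)⁻¹ ^ j < t → j₀ ≤ j := fun j hj => Nat.find_min' hex hj
    -- termwise domination by the geometric series started at `j₀`
    have hterm : ∀ j, (if T * (2 : ℝ)⁻¹ ^ j < t then (T * (2 : ℝ)⁻¹ ^ j) ^ β else 0) ≤
        if j₀ ≤ j then t ^ β * q ^ (j - j₀) else 0 := by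
      intro j
      split_ifs with h1 h2 h2
      · -- `j₀ ≤ j`: `(T 2^{-j})^β = (T 2^{-j₀})^β (2^{-β})^{j - j₀} ≤ t^β q^{j-j₀}`
        have hTj : 0 < T * (2 : ℝ)⁻¹ ^ j := by positivity
        have hsplit : T * (2 : ℝ)⁻¹ ^ j = (T * (2 : ℝ)⁻¹ ^ j₀) * (2 : ℝ)⁻¹ ^ (j - j₀) := by
          rw [mul_assoc, ← pow_add, Nat.add_sub_cancel' h2]
        rw [hsplit, Real.mul_rpow (by positivity) (by positivity)]
        have hqpow : ((2 : ℝ)⁻¹ ^ (j - j₀)) ^ β = q ^ (j - j₀) := by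
          rw [hq, ← Real.rpow_natCast, ← Real.rpow_mul (by norm_num), mul_comm,
            Real.rpow_mul (by norm_num), Real.rpow_natCast, Real.inv_rpow (by norm_num),
            Real.rpow_neg (by norm_num)]
        rw [hqpow]
        exact mul_le_mul_of_nonneg_right
          (Real.rpow_le_rpow (by positivity) hj₀.le hβ.le) (pow_nonneg hq0 _)
      · exact absurd (hmin j h1) h2
      · positivity
      · exact le_rfl
    calc ∑ j ∈ Finset.range n, (if T * (2 : ℝ)⁻¹ ^ j < t then (T * (2 : ℝ)⁻¹ ^ j) ^ β else 0)
        ≤ ∑ j ∈ Finset.range n, (if j₀ ≤ j then t ^ β * q ^ (j - j₀) else 0) :=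
          Finset.sum_le_sum fun j _ => hterm j
      _ = ∑ j ∈ (Finset.range n).filter (fun j => j₀ ≤ j), t ^ β * q ^ (j - j₀) := by
          rw [Finset.sum_filter]
      _ ≤ ∑ j ∈ Finset.Ico j₀ (j₀ + n), t ^ β * q ^ (j - j₀) := by
          refine Finset.sum_le_sum_of_subset_of_nonneg (fun j hj => ?_) fun j _ _ =>
            mul_nonneg htβ.le (pow_nonneg hq0 _)
          simp only [Finset.mem_filter, Finset.mem_range] at hj
          exact Finset.mem_Ico.2 ⟨hj.2, by omega⟩
      _ = t ^ β * ∑ k ∈ Finset.range n, q ^ k := by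
          rw [Finset.mul_sum, Finset.sum_Ico_eq_sum_range, Nat.add_sub_cancel_left]
          refine Finset.sum_congr rfl fun k _ => ?_
          rw [Nat.add_sub_cancel_left]
      _ ≤ t ^ β * (1 - q)⁻¹ := by
          refine mul_le_mul_of_nonneg_left ?_ htβ.le
          have h := geom_sum_Ico_le_of_lt_one (m := 0) (n := n) hq0 hq1
          rw [← Finset.range_eq_Ico, pow_zero, one_div] at h
          exact h
      _ = t ^ β / (1 - q) := by rw [div_eq_mul_inv]
  · push Not at hex
    calc ∑ j ∈ Finset.range n, (if T * (2 : ℝ)⁻¹ ^ j < t then (T * (2 : ℝ)⁻¹ ^ j) ^ β else 0)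
        = 0 := Finset.sum_eq_zero fun j _ => if_neg (not_lt.2 (hex j))
      _ ≤ t ^ β / (1 - q) := div_nonneg htβ.le hq1'.le

/-- **Resummation of the dyadic layers, as a series**: for `β > 0`, `T > 0`, `t > 0` the series
`Σ_j [T2^{-j} < t] (T2^{-j})^β` is summable with sum `≤ t^β/(1 - 2^{-β})`
(`sum_range_dyadic_rpow_le` and `Real.tsum_le_of_sum_range_le`). [cite: CoiculescuPalasek2025, proof of Prop. 4.3] -/
theorem tsum_dyadic_rpow_le {β T t : ℝ} (hβ : 0 < β) (hT : 0 < T) (ht : 0 < t) :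
    Summable (fun j : ℕ => if T * (2 : ℝ)⁻¹ ^ j < t then (T * (2 : ℝ)⁻¹ ^ j) ^ β else 0) ∧
      ∑' j : ℕ, (if T * (2 : ℝ)⁻¹ ^ j < t then (T * (2 : ℝ)⁻¹ ^ j) ^ β else 0) ≤
        t ^ β / (1 - (2 : ℝ) ^ (-β)) := by
  have hnn : ∀ j : ℕ, 0 ≤ (if T * (2 : ℝ)⁻¹ ^ j < t then (T * (2 : ℝ)⁻¹ ^ j) ^ β else 0) := by
    intro j
    split_ifs
    · positivity
    · exact le_rfl
  exact ⟨summable_of_sum_range_le hnn (sum_range_dyadic_rpow_le hβ hT ht),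
    Real.tsum_le_of_sum_range_le hnn (sum_range_dyadic_rpow_le hβ hT ht)⟩

end Literature.Analysis.ODE
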